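import Mathlib
import Literature.AlgebraicGeometry.Resolution.CobordantGame
import Literature.AlgebraicGeometry.Resolution.FormalCoordinateChange

/-!
# `WeightedInvariant.GlobalizeLocalDrop`, step (3) functoriality for smooth morphisms — the
# provable half: game values do not increase along cylinders

Route `ResolutionOfSingularities/WeightedInvariant`, support item `GlobalizeLocalDrop`
(stmt-ResolutionOfSingularities-14763): `LocalWeightedDrop → WeightedConstruction`.  A weighted
resolution datum must have an invariant functorial for SMOOTH morphisms (axiom (i) of
`Literature.….WeightedResolutionDatum`); formally-locally a smooth morphism is a projection
`Spf k[[x, z]] → Spf k[[x]]`, under which the local equation `h(x)` of a hypersurface becomes the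
CYLINDER `h(x) ∈ k[[x, z]]`.  So any globalisation of the canonical game rank `leastRank` of the crux
`LocalWeightedDrop` (see `WeightedInvariantGlobalizeLocalDropCanonize.lean`) needs
`leastRank (cyl h) = leastRank h`.  This file proves the half that holds by a strategy-copying
argument (the first line lead's (H3) for the least rank, stmt-8899 notes, "paper, routine", made a
theorem):

* `wonBy_rename_succAbove` — `WonBy α n h → WonBy α (n+1) (cylⱼ h)` for the cylinder
  `cylⱼ h = rename (Fin.succAbove j) h` along any slot `j : Fin (n+1)`: mirror the winning move
  `(θ, w)` of `h` as `(θ ⊗ id, w ⊕ 0)`; its transform is the cylinder (along the slot `j.succ`) of the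
  transform of `h` at the projected exceptional point (`subst_cruxChart_cylMove`), so its `s`-saturated
  singular successors are exactly the cylinders of those of `h` (`X`-adic factorisation
  `exists_eq_X_pow_mul_not_dvd` and its uniqueness `X_pow_mul_eq_X_pow_mul`), which are won by
  induction on `α` in one more variable;
* `wonBy_cyl`, `won_cyl`, `leastRank_cyl_le` — the same in the crux's `subst` spelling
  `cylⱼ h = MvPowerSeries.subst (fun m => X (j.succAbove m)) h`, and the inequality
  `leastRank (n+1) (cylⱼ h) ≤ leastRank n h` for won `h`.

Deliberately NOT here: the converse inequality ("decylindering": a strategy for the cylinder that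
uses the extra variable can be simulated on `h`), which is the open half of smooth functoriality.
-/

set_option linter.dupNamespace false -- mandated namespace of this single-conjunct summit

namespace Summit.ResolutionOfSingularities.ResolutionOfSingularities.Theorems

open Literature.AlgebraicGeometry.Resolution
open Literature.AlgebraicGeometry.Resolution.CobordantGame

variable {k : Type} [Field k]

/-! ### 1. `X`-adic factorisation in `k[[x]]` -/

/-- Every non-zero series factors as `X_s ^ a · g` with `X_s ∤ g`. -/
theorem exists_eq_X_pow_mul_not_dvd {m : ℕ} (s : Fin m) {F : MvPowerSeries (Fin m) k} (hF : F ≠ 0) :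
    ∃ (a : ℕ) (g : MvPowerSeries (Fin m) k), F = MvPowerSeries.X s ^ a * g ∧ ¬ MvPowerSeries.X s ∣ g := by
  classical
  -- some power of `X_s` does not divide `F`
  have hex : ∃ a : ℕ, ¬ MvPowerSeries.X s ^ (a + 1) ∣ F := by
    obtain ⟨e, he⟩ : ∃ e, MvPowerSeries.coeff e F ≠ 0 := by
      by_contra hcon
      push Not at hcon
      exact hF (MvPowerSeries.ext hcon)
    refine ⟨e s, fun hdvd => he ?_⟩
    exact (MvPowerSeries.X_pow_dvd_iff.mp hdvd) e (Nat.lt_succ_self _)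
  let a := Nat.find hex
  have hdvd : MvPowerSeries.X s ^ a ∣ F := by
    rcases Nat.eq_zero_or_eq_succ_pred a with h0 | hsucc
    · rw [h0, pow_zero]; exact one_dvd _
    · have hlt : a - 1 < a := by omega
      have := Nat.find_min hex (m := a - 1) hlt
      push Not at this
      rwa [show a - 1 + 1 = a by omega] at this
  obtain ⟨g, hg⟩ := hdvd
  refine ⟨a, g, hg, fun hXg => Nat.find_spec hex ?_⟩
  obtain ⟨q, hq⟩ := hXg
  refine ⟨q, ?_⟩
  calc F = MvPowerSeries.X s ^ a * g := hg
    _ = MvPowerSeries.X s ^ a * (MvPowerSeries.X s * q) := by rw [hq]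
    _ = MvPowerSeries.X s ^ (a + 1) * q := by ring

/-- Uniqueness of the `X`-adic factorisation: `X_s ^ a · g = X_s ^ a' · g'` with `X_s ∤ g, g'` forces
`a = a'` and `g = g'`. -/
theorem X_pow_mul_eq_X_pow_mul {m : ℕ} (s : Fin m) {a a' : ℕ} {g g' : MvPowerSeries (Fin m) k}
    (h : MvPowerSeries.X s ^ a * g = MvPowerSeries.X s ^ a' * g') (hg : ¬ MvPowerSeries.X s ∣ g)
    (hg' : ¬ MvPowerSeries.X s ∣ g') : a = a' ∧ g = g' := by
  -- the case `a ≤ a'`, then symmetry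
  have key : ∀ {b b' : ℕ} {G G' : MvPowerSeries (Fin m) k}, b ≤ b' →
      MvPowerSeries.X s ^ b * G = MvPowerSeries.X s ^ b' * G' → ¬ MvPowerSeries.X s ∣ G → b = b' ∧ G = G' := by
    intro b b' G G' hle hGG hG
    obtain ⟨d, rfl⟩ := Nat.exists_eq_add_of_le hle
    have hX : (MvPowerSeries.X s : MvPowerSeries (Fin m) k) ^ b ≠ 0 :=
      pow_ne_zero _ (FormalCoordChange.X_ne_zero' s)
    rw [pow_add, mul_assoc] at hGG
    have hG' : G = MvPowerSeries.X s ^ d * G' := mul_left_cancel₀ hX hGG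
    rcases Nat.eq_zero_or_pos d with hd | hd
    · subst hd
      exact ⟨by simp, by simpa using hG'⟩
    · exfalso
      apply hG
      refine ⟨MvPowerSeries.X s ^ (d - 1) * G', ?_⟩
      rw [hG', ← mul_assoc, ← pow_succ', Nat.sub_add_cancel hd]
  rcases le_total a a' with hle | hle
  · exact key hle h hg
  · obtain ⟨h1, h2⟩ := key hle h.symm hg'
    exact ⟨h1.symm, h2.symm⟩

/-! ### 2. Renaming along `Fin.succAbove` (cylinders) -/

/-- Renaming commutes with substitution: `rename ε (a^* F) = (rename ε ∘ a)^* F` for a substitution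
`a` by series without constant terms. -/
theorem rename_subst_eq {n m m' : ℕ} (ε : Fin m ↪ Fin m') (a : Fin n → MvPowerSeries (Fin m) k)
    (ha : ∀ i, MvPowerSeries.constantCoeff (a i) = 0) (F : MvPowerSeries (Fin n) k) :
    MvPowerSeries.rename ε (MvPowerSeries.subst a F) =
      MvPowerSeries.subst (fun i => MvPowerSeries.rename ε (a i)) F := by
  rw [MvPowerSeries.rename_eq_subst, MvPowerSeries.subst_comp_subst_apply
    (MvPowerSeries.hasSubst_of_constantCoeff_zero ha) (MvPowerSeries.HasSubst.X_comp _)]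
  congr 1
  funext i
  rw [MvPowerSeries.rename_eq_subst]

/-- Substituting into a renamed series: `b^*(rename ε F) = (b ∘ ε)^* F`. -/
theorem subst_rename_eq {n n' m : ℕ} (ε : Fin n ↪ Fin n') (b : Fin n' → MvPowerSeries (Fin m) k)
    (hb : ∀ i, MvPowerSeries.constantCoeff (b i) = 0) (F : MvPowerSeries (Fin n) k) :
    MvPowerSeries.subst b (MvPowerSeries.rename ε F) = MvPowerSeries.subst (fun i => b (ε i)) F := by
  have hbs := MvPowerSeries.hasSubst_of_constantCoeff_zero hb
  rw [MvPowerSeries.rename_eq_subst, MvPowerSeries.subst_comp_subst_apply (MvPowerSeries.HasSubst.X_comp _) hbs]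
  congr 1
  funext i
  exact MvPowerSeries.subst_X hbs (ε i)

/-- The cylinder embedding one slot further up fixes the exceptional variable `s = X 0`. -/
theorem succAboveEmb_succ_zero {n : ℕ} (j : Fin (n + 1)) : Fin.succAboveEmb j.succ (0 : Fin (n + 1)) = 0 := by
  simp [Fin.succAboveEmb]

/-- `X 0 ∤ g` is preserved by the cylinder along a slot `j.succ ≠ 0`. -/
theorem not_X_dvd_rename_succAbove {n : ℕ} (j : Fin (n + 1)) {g : MvPowerSeries (Fin (n + 1)) k}
    (hg : ¬ MvPowerSeries.X 0 ∣ g) : ¬ MvPowerSeries.X 0 ∣ MvPowerSeries.rename (Fin.succAboveEmb j.succ) g := by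
  rintro ⟨q, hq⟩
  apply hg
  refine ⟨MvPowerSeries.killCompl (Fin.succAboveEmb j.succ) q, ?_⟩
  have := congrArg (MvPowerSeries.killCompl (R := k) (Fin.succAboveEmb j.succ)) hq
  rw [MvPowerSeries.killCompl_rename_app, map_mul] at this
  rw [this, ← succAboveEmb_succ_zero j, MvPowerSeries.killCompl_X]

/-- `𝔪²`-membership descends from the cylinder to the series. -/
theorem singular_of_singular_rename {n : ℕ} (ε : Fin (n + 1) ↪ Fin (n + 2)) {g : MvPowerSeries (Fin (n + 1)) k}
    (h : MvPowerSeries.constantCoeff (MvPowerSeries.rename ε g) = 0 ∧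
      ∀ j, MvPowerSeries.coeff (Finsupp.single j 1) (MvPowerSeries.rename ε g) = 0) :
    MvPowerSeries.constantCoeff g = 0 ∧ ∀ j, MvPowerSeries.coeff (Finsupp.single j 1) g = 0 := by
  refine ⟨by simpa [MvPowerSeries.constantCoeff_rename] using h.1, fun j => ?_⟩
  have := h.2 (ε j)
  rwa [← Finsupp.embDomain_single, MvPowerSeries.coeff_embDomain_rename] at this

/-! ### 3. The mirrored move `(θ ⊗ id, w ⊕ 0)` along the slot `j` -/

/-- The components of the crux's chart have zero constant terms. -/
private theorem constantCoeff_cruxChart' {n : ℕ} (w : Fin n → ℕ) (c : Fin n → k) (i : Fin n) :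
    MvPowerSeries.constantCoeff (cruxChart k w c i) = 0 := by
  unfold cruxChart
  split_ifs with h
  · simp [MvPowerSeries.constantCoeff_X, zero_pow (Nat.pos_iff_ne_zero.mp h)]
  · simp [MvPowerSeries.constantCoeff_X]

section CylMove

variable {n : ℕ} (j : Fin (n + 1)) (θ : Fin n → MvPowerSeries (Fin n) k) (w : Fin n → ℕ)

/-- The mirrored coordinate change `θ ⊗ id` (identity on the new slot `j`, `θ` renamed into the other
slots) has zero constant terms. -/
theorem constantCoeff_cylMove (hθ0 : ∀ i, MvPowerSeries.constantCoeff (θ i) = 0) (i : Fin (n + 1)) :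
    MvPowerSeries.constantCoeff (Fin.insertNth (α := fun _ => MvPowerSeries (Fin (n + 1)) k) j
      (MvPowerSeries.X j) (fun m => MvPowerSeries.rename (Fin.succAboveEmb j) (θ m)) i) = 0 := by
  rcases Fin.eq_self_or_eq_succAbove j i with rfl | ⟨m, rfl⟩
  · rw [Fin.insertNth_apply_same]
    exact MvPowerSeries.constantCoeff_X _
  · rw [Fin.insertNth_apply_succAbove, MvPowerSeries.constantCoeff_rename]
    exact hθ0 m

/-- The linear part of `θ ⊗ id` has the same determinant as that of `θ` (Laplace expansion along the
row of the new slot, whose only entry is the diagonal `1`). -/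
theorem det_linMat_cylMove :
    (Matrix.of fun i i' => MvPowerSeries.coeff (Finsupp.single i' 1)
      (Fin.insertNth (α := fun _ => MvPowerSeries (Fin (n + 1)) k) j (MvPowerSeries.X j)
        (fun m => MvPowerSeries.rename (Fin.succAboveEmb j) (θ m)) i)).det =
    (Matrix.of fun m m' => MvPowerSeries.coeff (Finsupp.single m' 1) (θ m)).det := by
  classical
  set A := (Matrix.of fun i i' => MvPowerSeries.coeff (Finsupp.single i' 1)
      (Fin.insertNth (α := fun _ => MvPowerSeries (Fin (n + 1)) k) j (MvPowerSeries.X j)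
        (fun m => MvPowerSeries.rename (Fin.succAboveEmb j) (θ m)) i)) with hA
  have hrow : ∀ i', A j i' = if i' = j then 1 else 0 := by
    intro i'
    simp only [hA, Matrix.of_apply, Fin.insertNth_apply_same, MvPowerSeries.coeff_X]
    by_cases h : i' = j
    · subst h; simp
    · rw [if_neg h, if_neg]
      exact fun hh => h ((Finsupp.single_left_inj one_ne_zero).mp hh)
  have hsub : A.submatrix j.succAbove j.succAbove =
      Matrix.of fun m m' => MvPowerSeries.coeff (Finsupp.single m' 1) (θ m) := by
    ext m m'
    simp only [hA, Matrix.submatrix_apply, Matrix.of_apply, Fin.insertNth_apply_succAbove]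
    rw [show (Finsupp.single (j.succAbove m') 1 : Fin (n + 1) →₀ ℕ) =
        Finsupp.embDomain (Fin.succAboveEmb j) (Finsupp.single m' 1) by
      rw [Finsupp.embDomain_single]; rfl, MvPowerSeries.coeff_embDomain_rename]
  rw [Matrix.det_succ_row A j, Finset.sum_eq_single j, hrow, if_pos rfl, mul_one, hsub,
    Even.neg_one_pow ⟨j, rfl⟩, one_mul]
  · intro i' _ hne
    rw [hrow, if_neg hne, mul_zero, zero_mul]
  · intro h
    exact absurd (Finset.mem_univ j) h

/-- The mirrored move `(θ ⊗ id, w ⊕ 0)` is a legal move in `n + 1` variables. -/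
theorem isMove_cylMove (hm : IsMove k θ w) :
    IsMove k (Fin.insertNth (α := fun _ => MvPowerSeries (Fin (n + 1)) k) j (MvPowerSeries.X j)
        (fun m => MvPowerSeries.rename (Fin.succAboveEmb j) (θ m)))
      (Fin.insertNth (α := fun _ => ℕ) j 0 w) := by
  obtain ⟨hθ0, hdet, i₀, hi₀⟩ := hm
  refine ⟨constantCoeff_cylMove j θ hθ0, ?_, ⟨j.succAbove i₀, ?_⟩⟩
  · rw [det_linMat_cylMove]
    exact hdet
  · rw [Fin.insertNth_apply_succAbove]
    exact hi₀

/-- `(θ ⊗ id)^*` of a cylinder is the cylinder of `θ^*`. -/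
theorem subst_cylMove_rename (hθ0 : ∀ i, MvPowerSeries.constantCoeff (θ i) = 0)
    (h : MvPowerSeries (Fin n) k) :
    MvPowerSeries.subst (Fin.insertNth (α := fun _ => MvPowerSeries (Fin (n + 1)) k) j (MvPowerSeries.X j)
        (fun m => MvPowerSeries.rename (Fin.succAboveEmb j) (θ m)))
      (MvPowerSeries.rename (Fin.succAboveEmb j) h) =
    MvPowerSeries.rename (Fin.succAboveEmb j) (MvPowerSeries.subst θ h) := by
  rw [subst_rename_eq (Fin.succAboveEmb j) _ (constantCoeff_cylMove j θ hθ0) h,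
    rename_subst_eq (Fin.succAboveEmb j) θ hθ0 h]
  congr 1
  funext m
  exact Fin.insertNth_apply_succAbove j _ _ m

/-- The chart of the mirrored weights at `c'`, in the old slots, is the cylinder (along `j.succ`) of
the chart of `w` at the projected point `c' ∘ j.succAbove`. -/
theorem cruxChart_cylWeight (c' : Fin (n + 1) → k) (m : Fin n) :
    cruxChart k (Fin.insertNth (α := fun _ => ℕ) j 0 w) c' (j.succAbove m) =
      MvPowerSeries.rename (Fin.succAboveEmb j.succ) (cruxChart k w (fun m => c' (j.succAbove m)) m) := by
  have h0 : (Fin.succAboveEmb j.succ) (0 : Fin (n + 1)) = 0 := succAboveEmb_succ_zero j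
  have hs : (Fin.succAboveEmb j.succ) m.succ = (j.succAbove m).succ := Fin.succ_succAbove_succ j m
  simp only [cruxChart, Fin.insertNth_apply_succAbove]
  split_ifs with hw
  · rw [map_mul, map_pow, map_add, MvPowerSeries.rename_X, MvPowerSeries.rename_C,
      MvPowerSeries.rename_X, h0, hs]
  · rw [MvPowerSeries.rename_X, hs]

/-- THE TRANSFORM OF A CYLINDER IS THE CYLINDER OF THE TRANSFORM: under the mirrored move and at the
exceptional point `c'`, the transform of `cylⱼ h` is the cylinder along `j.succ` of the transform of
`h` under `(θ, w)` at `c' ∘ j.succAbove`. -/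
theorem subst_cruxChart_cylMove (hθ0 : ∀ i, MvPowerSeries.constantCoeff (θ i) = 0)
    (c' : Fin (n + 1) → k) (h : MvPowerSeries (Fin n) k) :
    MvPowerSeries.subst (cruxChart k (Fin.insertNth (α := fun _ => ℕ) j 0 w) c')
      (MvPowerSeries.subst (Fin.insertNth (α := fun _ => MvPowerSeries (Fin (n + 1)) k) j
        (MvPowerSeries.X j) (fun m => MvPowerSeries.rename (Fin.succAboveEmb j) (θ m)))
        (MvPowerSeries.rename (Fin.succAboveEmb j) h)) =
    MvPowerSeries.rename (Fin.succAboveEmb j.succ)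
      (MvPowerSeries.subst (cruxChart k w (fun m => c' (j.succAbove m))) (MvPowerSeries.subst θ h)) := by
  rw [subst_cylMove_rename j θ hθ0 h,
    subst_rename_eq (Fin.succAboveEmb j) _ (constantCoeff_cruxChart' _ c') (MvPowerSeries.subst θ h),
    rename_subst_eq (Fin.succAboveEmb j.succ) _ (constantCoeff_cruxChart' w _) (MvPowerSeries.subst θ h)]
  congr 1
  funext m
  exact cruxChart_cylWeight j w c' m

end CylMove

/-! ### 4. Game values do not increase along cylinders -/

/-- CYLINDERS ARE WON AT LEAST AS FAST: `WonBy α n h → WonBy α (n+1) (cylⱼ h)` for every slot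
`j : Fin (n+1)`, `cylⱼ h = rename (Fin.succAbove j) h` (strategy copying: mirror the move; the singular
`s`-saturated successors of the cylinder are the cylinders, along `j.succ`, of those of `h`). -/
theorem wonBy_rename_succAbove {α : Ordinal.{0}} :
    ∀ {n : ℕ} (j : Fin (n + 1)) {h : MvPowerSeries (Fin n) k}, WonBy k α n h →
      WonBy k α (n + 1) (MvPowerSeries.rename (Fin.succAboveEmb j) h) := by
  induction α using WellFoundedLT.induction with
  | ind α ih =>
    intro n j h hW
    rw [wonBy_iff] at hW ⊢
    obtain ⟨θ, w, hm, hs⟩ := hW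
    refine ⟨Fin.insertNth (α := fun _ => MvPowerSeries (Fin (n + 1)) k) j (MvPowerSeries.X j)
        (fun m => MvPowerSeries.rename (Fin.succAboveEmb j) (θ m)),
      Fin.insertNth (α := fun _ => ℕ) j 0 w, isMove_cylMove j θ w hm, fun g' hg' => ?_⟩
    obtain ⟨c', a', hoff', hfac', hndvd', hsing'⟩ := hg'
    -- the projected exceptional point is off the vertex of `w`
    have hoff : ∃ i, 0 < w i ∧ (fun m => c' (j.succAbove m)) i ≠ 0 := by
      obtain ⟨i, hwi, hci⟩ := hoff'
      rcases Fin.eq_self_or_eq_succAbove j i with rfl | ⟨m, rfl⟩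
      · rw [Fin.insertNth_apply_same] at hwi
        exact absurd hwi (lt_irrefl 0)
      · rw [Fin.insertNth_apply_succAbove] at hwi
        exact ⟨m, hwi, hci⟩
    -- the transform of the cylinder is the cylinder of the transform `T` of `h`
    rw [subst_cruxChart_cylMove j θ w hm.1 c' h] at hfac'
    set T := MvPowerSeries.subst (cruxChart k w (fun m => c' (j.succAbove m))) (MvPowerSeries.subst θ h)
      with hT
    have hTne : T ≠ 0 := by
      intro h0
      rw [h0, map_zero] at hfac'
      have hg'0 : g' = 0 := by
        rcases mul_eq_zero.mp hfac'.symm with h1 | h1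
        · exact absurd h1 (pow_ne_zero _ (FormalCoordChange.X_ne_zero' _))
        · exact h1
      exact hndvd' (hg'0 ▸ dvd_zero _)
    -- `X 0`-adic factorisation of `T` and uniqueness: `g'` is the cylinder of the successor `g` of `h`
    obtain ⟨a, g, hTfac, hg⟩ := exists_eq_X_pow_mul_not_dvd 0 hTne
    have hren : MvPowerSeries.rename (Fin.succAboveEmb j.succ) T =
        MvPowerSeries.X 0 ^ a * MvPowerSeries.rename (Fin.succAboveEmb j.succ) g := by
      rw [hTfac, map_mul, map_pow, MvPowerSeries.rename_X, succAboveEmb_succ_zero]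
    obtain ⟨-, hgg'⟩ := X_pow_mul_eq_X_pow_mul 0 (hren.symm.trans hfac')
      (not_X_dvd_rename_succAbove j hg) hndvd'
    subst hgg'
    have hsing := singular_of_singular_rename (Fin.succAboveEmb j.succ) hsing'
    obtain ⟨β, hβ, hWg⟩ := hs g ⟨fun m => c' (j.succAbove m), a, hoff, hTfac, hg, hsing⟩
    exact ⟨β, hβ, ih β hβ j.succ hWg⟩

/-- The cylinder in the crux's `subst` spelling is the renaming along `Fin.succAbove j`. -/
theorem subst_X_succAbove_eq_rename {n : ℕ} (j : Fin (n + 1)) (h : MvPowerSeries (Fin n) k) :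
    MvPowerSeries.subst (fun m : Fin n => (MvPowerSeries.X (j.succAbove m) : MvPowerSeries (Fin (n + 1)) k)) h =
      MvPowerSeries.rename (Fin.succAboveEmb j) h := by
  rw [MvPowerSeries.rename_eq_subst]
  rfl

/-- (H3) FOR THE GAME VALUES: `WonBy α n h → WonBy α (n+1) (cylⱼ h)` with the cylinder spelled as in
the crux's line `vertex-descent-weight-residues` (`X m ↦ X (j.succAbove m)`). -/
theorem wonBy_cyl {α : Ordinal.{0}} {n : ℕ} (j : Fin (n + 1)) {h : MvPowerSeries (Fin n) k}
    (hW : WonBy k α n h) :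
    WonBy k α (n + 1) (MvPowerSeries.subst
      (fun m : Fin n => (MvPowerSeries.X (j.succAbove m) : MvPowerSeries (Fin (n + 1)) k)) h) := by
  rw [subst_X_succAbove_eq_rename]
  exact wonBy_rename_succAbove j hW

/-- The cylinder of a won germ is won. -/
theorem won_cyl {n : ℕ} (j : Fin (n + 1)) {h : MvPowerSeries (Fin n) k} (hW : Won k n h) :
    Won k (n + 1) (MvPowerSeries.subst
      (fun m : Fin n => (MvPowerSeries.X (j.succAbove m) : MvPowerSeries (Fin (n + 1)) k)) h) := by
  obtain ⟨α, hα⟩ := hW.exists_wonBy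
  exact (wonBy_cyl j hα).won

/-- (H3) FOR THE LEAST GAME RANK: `leastRank (n+1) (cylⱼ h) ≤ leastRank n h` for every won germ `h`
(in particular for every singular germ under `LocalWeightedDrop`). -/
theorem leastRank_cyl_le {n : ℕ} (j : Fin (n + 1)) {h : MvPowerSeries (Fin n) k} (hW : Won k n h) :
    leastRank (n + 1) (MvPowerSeries.subst
      (fun m : Fin n => (MvPowerSeries.X (j.succAbove m) : MvPowerSeries (Fin (n + 1)) k)) h) ≤
      leastRank n h :=
  leastRank_le (wonBy_cyl j (wonBy_leastRank hW))

end Summit.ResolutionOfSingularities.ResolutionOfSingularities.Theorems
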